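import Summits.QuantumFields.YangMills.Theorems.LuscherReductionTwistedTraceScalingInnerSlowManifold
import Summits.QuantumFields.YangMills.Theorems.LuscherReductionTwistedTraceScalingBTTubeKinetic
import HarnessLib

/-!
# The MAGNETIC energy on the orthographic tube around the slow manifold: `S(orthoTube u v) = L³S₁(u) + [‖D_u v‖² weighted] ± E` with NO LINEAR TERM for BALANCED `v`
# (lane A of S-BASE, crux `TwistedTraceScaling` stmt-QuantumFields-20203, C4-CORE, the (B-T) pen (F1c); design note `pub/ym-fleet/ym-luscher-20007-p1/COARSE-DESIGN.md` §25.3, §25.6)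

The magnetic half of the Laplace phase of `fpBOKernel` around the slow manifold.  `…InnerSlowManifold` (g11) proved the two-sided expansion of the Wilson action of a step `W·constLift u` with
NO linear term for steps in the STIFF space (`linkVec W ⊥ ker D_1̄`); the orthographic tube `orthoTube u v = (chartSU2 ∘ v)·constLift u` (`orthoTube_eq_mul_constLift`) takes BALANCED steps
(`Σ_x v_{(x,k)} = 0`), which are orthogonal to the nine CONSTANT modes but not to the linearised gauge modes.  That is enough: the gradient of `S` at `constLift u` is a constant mode
(`adjoint_covCurl_plaqCurv_constLift_mem_constModes`).
* §1 `inner_constMode_linkEmbed_eq_zero` — a constant mode is orthogonal to every balanced link field; ★ `inner_covCurl_linkEmbed_plaqCurv_constLift_eq_zero` — `⟪D_u v, F(constLift u)⟫ = 0` for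
  balanced `v` (the linear term of the action along the tube VANISHES, exactly — the magnetic half of «the constant lift is a critical point», §25.3);
* §2 `linkVec_chartSU2_eq_linkEmbed` (on the cap), and ★★ `wilsonAction_orthoTube_le` / `wilsonAction_orthoTube_ge`: for `v ∈ capBalancedSet L` with `|v_{e,c}| ≤ τ ≤ 1/30` and
  `L³S₁(u) ≤ σ < 2`:  `L³S₁(u) + (1 − σ/2)‖D_u v‖² − E ≤ S(orthoTube u v) ≤ L³S₁(u) + ‖D_u v‖² + E`, `E = stepActionErr τ σ = |P|(1728τ²√σ + 29376τ³ + 700569τ⁴)`, `D_u = covCurl (constLift u)`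
  the covariant curl.  At the record scales (`τ = β^{-1/2}log β`, `σ = O(L³β·β^{-4s})`… i.e. `S₁(u) = O(δ⁴)` on the window): `βE = O(β^{-1/2}log³β)` — inside the budget of §25.3.
HONEST FRAMING: fixed-lattice algebra (a corollary of g11's `…StepActionExact`/`…InnerSlowManifold`) for a stub of a child of the CONDITIONAL reduction route R2b1; the Laplace core of (B-T) is
OPEN; C4-CORE OPEN; not infinite volume, not a gap, not Clay.
-/

set_option autoImplicit false

noncomputable section

open MeasureTheory Filter Topology Real
open scoped BigOperators Matrix InnerProductSpace RealInnerProductSpace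
open Literature.MathematicalPhysics.QuantumFieldTheory
open Literature.MathematicalPhysics.QuantumLattice

namespace Summit.QuantumFields.YangMills.Theorems.FemtoTransferGap.TwoLattice.ConstTube

open Summit.QuantumFields.YangMills.Theorems.FemtoTransferGap
open Summit.QuantumFields.YangMills.Theorems.FemtoTransferGap.TwoLattice
open Summit.QuantumFields.YangMills.Theorems.FemtoTransferGap.TwoLattice.Stiff
open Summit.QuantumFields.YangMills.Theorems.FemtoTransferGap.TwoLattice.Cov
open Summit.QuantumFields.YangMills.Theorems.FemtoTransferGap.TwoLattice.Toron

variable {L : ℕ} [NeZero L]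

/-! ## §1 Balanced link fields are orthogonal to the constant modes; no linear term -/

/-- A constant mode is orthogonal to every balanced link field. [folklore] -/
theorem inner_constMode_linkEmbed_eq_zero {m : LinkSpace L} (hm : m ∈ constModes L) {v : Edge 3 L → Fin 3 → ℝ} (hv : v ∈ balancedSet L) :
    ⟪m, linkEmbed L v⟫ = 0 := by
  rw [eq_constForm_of_mem_constModes hm]
  rw [PiLp.inner_apply]
  simp only [linkEmbed_apply, RCLike.inner_apply, conj_trivial]
  rw [Fintype.sum_prod_type, Fintype.sum_prod_type, Finset.sum_comm]
  refine Finset.sum_eq_zero fun k _ => ?_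
  rw [Finset.sum_comm]
  refine Finset.sum_eq_zero fun a _ => ?_
  dsimp only
  rw [← Finset.sum_mul, hv k a, zero_mul]

/-- ★ **No linear term along the tube**: `⟪D_u (linkEmbed v), F(constLift u)⟫ = 0` for balanced `v` (the gradient of the action at `constLift u` is a constant mode). [cite: Luscher1983, §3] -/
theorem inner_covCurl_linkEmbed_plaqCurv_constLift_eq_zero (u : GaugeConfig 3 1 SU2) {v : Edge 3 L → Fin 3 → ℝ} (hv : v ∈ balancedSet L) :
    ⟪covCurl (constLift L u) (linkEmbed L v), plaqCurv (constLift L u)⟫ = 0 := by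
  rw [← LinearMap.adjoint_inner_right, real_inner_comm]
  exact inner_constMode_linkEmbed_eq_zero (adjoint_covCurl_plaqCurv_constLift_mem_constModes u) hv

/-! ## §2 ★★ The Wilson action on the tube -/

omit [NeZero L] in
/-- On the cap the vector parts of the orthographic step are the coordinates: `linkVec (chartSU2 ∘ v) = linkEmbed v`. [folklore] -/
theorem linkVec_chartSU2_eq_linkEmbed {v : Edge 3 L → Fin 3 → ℝ} (hv : ∀ e : Edge 3 L, ∑ a, v e a ^ 2 ≤ 1) :
    linkVec L (fun e => chartSU2 (v e)) = linkEmbed L v := by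
  ext ea
  rw [show ea = (ea.1, ea.2) from rfl, linkVec_apply, linkEmbed_apply, vecPart_chartSU2 (hv ea.1)]

/-- ★★ **UPPER**: `S(orthoTube u v) ≤ L³S₁(u) + ‖D_u v‖² + E` for `v ∈ capBalancedSet L`, `|v_{e,c}| ≤ τ ≤ 1/30`, `L³S₁(u) ≤ σ < 2`. [cite: Luscher1983, §3] -/
theorem wilsonAction_orthoTube_le (u : GaugeConfig 3 1 SU2) {v : Edge 3 L → Fin 3 → ℝ} (hv : v ∈ capBalancedSet L) {τ σ : ℝ} (hτ : τ ≤ 1 / 30) (hσ : σ < 2)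
    (hS : (L : ℝ) ^ 3 * wilsonAction su2Rep u ≤ σ) (hvτ : ∀ (e : Edge 3 L) (c : Fin 3), |v e c| ≤ τ) :
    wilsonAction su2Rep (orthoTube L u v) ≤ (L : ℝ) ^ 3 * wilsonAction su2Rep u + ‖covCurl (constLift L u) (linkEmbed L v)‖ ^ 2 + stepActionErr (L := L) τ σ := by
  have hv1 : ∀ e : Edge 3 L, ∑ a, v e a ^ 2 ≤ 1 := sum_sq_le_one_of_cap L hv.2
  have hS' : wilsonAction su2Rep (constLift L u) ≤ σ := by rw [wilsonAction_constLift_eq]; exact hS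
  have hs : ∀ e : Edge 3 L, 0 ≤ scalarPart ((fun e => chartSU2 (v e)) e) := fun e => by
    show 0 ≤ scalarPart (chartSU2 (v e)); rw [scalarPart_chartSU2 (hv1 e)]; exact Real.sqrt_nonneg _
  have hw : ∀ (e : Edge 3 L) (c : Fin 3), |vecPart ((fun e => chartSU2 (v e)) e) c| ≤ τ := fun e c => by
    show |vecPart (chartSU2 (v e)) c| ≤ τ; rw [vecPart_chartSU2 (hv1 e)]; exact hvτ e c
  have h := wilsonAction_step_le_valley (fun e => chartSU2 (v e)) (constLift L u) hτ hσ hS' hs hw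
  rw [linkVec_chartSU2_eq_linkEmbed hv1, inner_covCurl_linkEmbed_plaqCurv_constLift_eq_zero u hv.1, mul_zero, add_zero, ← orthoTube_eq_mul_constLift,
    wilsonAction_constLift_eq] at h
  exact h

/-- ★★ **LOWER**: `L³S₁(u) + (1 − σ/2)‖D_u v‖² − E ≤ S(orthoTube u v)` under the same hypotheses. [cite: Luscher1983, §3] -/
theorem wilsonAction_orthoTube_ge (u : GaugeConfig 3 1 SU2) {v : Edge 3 L → Fin 3 → ℝ} (hv : v ∈ capBalancedSet L) {τ σ : ℝ} (hτ : τ ≤ 1 / 30) (hσ : σ < 2)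
    (hS : (L : ℝ) ^ 3 * wilsonAction su2Rep u ≤ σ) (hvτ : ∀ (e : Edge 3 L) (c : Fin 3), |v e c| ≤ τ) :
    (L : ℝ) ^ 3 * wilsonAction su2Rep u + (1 - σ / 2) * ‖covCurl (constLift L u) (linkEmbed L v)‖ ^ 2 - stepActionErr (L := L) τ σ ≤ wilsonAction su2Rep (orthoTube L u v) := by
  have hv1 : ∀ e : Edge 3 L, ∑ a, v e a ^ 2 ≤ 1 := sum_sq_le_one_of_cap L hv.2
  have hS' : wilsonAction su2Rep (constLift L u) ≤ σ := by rw [wilsonAction_constLift_eq]; exact hS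
  have hs : ∀ e : Edge 3 L, 0 ≤ scalarPart ((fun e => chartSU2 (v e)) e) := fun e => by
    show 0 ≤ scalarPart (chartSU2 (v e)); rw [scalarPart_chartSU2 (hv1 e)]; exact Real.sqrt_nonneg _
  have hw : ∀ (e : Edge 3 L) (c : Fin 3), |vecPart ((fun e => chartSU2 (v e)) e) c| ≤ τ := fun e c => by
    show |vecPart (chartSU2 (v e)) c| ≤ τ; rw [vecPart_chartSU2 (hv1 e)]; exact hvτ e c
  have h := wilsonAction_step_ge_valley (fun e => chartSU2 (v e)) (constLift L u) hτ hσ hS' hs hw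
  rw [linkVec_chartSU2_eq_linkEmbed hv1, inner_covCurl_linkEmbed_plaqCurv_constLift_eq_zero u hv.1, mul_zero, add_zero, ← orthoTube_eq_mul_constLift,
    wilsonAction_constLift_eq] at h
  exact h

/-- ★★ **TWO-SIDED, absolute-value form**: `|S(orthoTube u v) − L³S₁(u) − ‖D_u v‖²| ≤ (σ/2)‖D_u v‖² + E`. [cite: Luscher1983, §3] -/
theorem abs_wilsonAction_orthoTube_sub_le (u : GaugeConfig 3 1 SU2) {v : Edge 3 L → Fin 3 → ℝ} (hv : v ∈ capBalancedSet L) {τ σ : ℝ} (hτ : τ ≤ 1 / 30) (hσ : σ < 2)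
    (hS : (L : ℝ) ^ 3 * wilsonAction su2Rep u ≤ σ) (hvτ : ∀ (e : Edge 3 L) (c : Fin 3), |v e c| ≤ τ) :
    |wilsonAction su2Rep (orthoTube L u v) - (L : ℝ) ^ 3 * wilsonAction su2Rep u - ‖covCurl (constLift L u) (linkEmbed L v)‖ ^ 2| ≤
      σ / 2 * ‖covCurl (constLift L u) (linkEmbed L v)‖ ^ 2 + stepActionErr (L := L) τ σ := by
  have h1 := wilsonAction_orthoTube_le u hv hτ hσ hS hvτ
  have h2 := wilsonAction_orthoTube_ge u hv hτ hσ hS hvτ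
  have hσ0 : 0 ≤ σ := le_trans (mul_nonneg (by positivity) (wilsonAction_su2_nonneg u)) hS
  rw [abs_le]
  constructor <;> nlinarith [sq_nonneg ‖covCurl (constLift L u) (linkEmbed L v)‖]

end Summit.QuantumFields.YangMills.Theorems.FemtoTransferGap.TwoLattice.ConstTube

end
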